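import Summits.AtomisticToContinuum.BoseEinsteinCondensation.Theses.BECInsertionCorrector
import Summits.AtomisticToContinuum.BoseEinsteinCondensation.Theorems.StaticResponseBound.Negative.Basic
import Summits.AtomisticToContinuum.BoseEinsteinCondensation.Theorems.BECInsertionCorrectorStaticResponseBoundEnergyFloorToPoincareFloor
import Summits.AtomisticToContinuum.BoseEinsteinCondensation.Theorems.BECInsertionCorrectorStaticResponseBoundSectorFloorToHMinusOnePart1
import Literature.MathematicalPhysics.QuantumManyBody.GroundStateDirichletForm
import Literature.MathematicalPhysics.QuantumManyBody.BoseGasStructureFactor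
import HarnessLib

/-!
# Feynman–Bijl: the sector floor forces hyperuniformity of exact torus ground states — calibration

Helper file for the crux `BECInsertionCorrector.StaticResponseBound` (item stmt-AtomisticToContinuum-12057),
line `stable-fraction-square-completion` (skeleton v5/v6, lead -2).  The line's open core B
`stub_sectorFloor` (Landau floor with saturation, ALL `N ≥ 1`) already contains the hyperuniformity of
EXACT real translation-invariant ground states at every window mode, for all `N`:
`N S_N(p) = ‖ρ̂_p‖²_Θ ≤ N|p|/(θ_L√(ρa))`, i.e. `S(p) ≤ |p|ξ/θ_L` — Feynman's `F = ρ̂_p` has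
`𝓔_Θ(ρ̂_p) = N|p|²` (`groundStateDirichletForm_planeWaveSum`), the energy floor in the sector `p`
transfers to the Poincaré constant of the minimiser's weight by the landed brick B4
(`stub_energyFloorToPoincareFloor`, ground-state transform), and `ω‖ρ̂_p‖²_Θ ≤ 𝓔_Θ(ρ̂_p)`
(`PeriodicTrialState.sectorPoincareConstant_latticeVec_le`).  This is the calibration edge
"SectorFloor ⟹ hyperuniformity of exact minimisers ∀N" (the exact-minimiser body of TorusHyperuniformity,
stmt-9093, at `C = 1/θ_L`), complementing the landed `ECSF ⟹ TorusHyperuniformity` (p89652) and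
`StaticResponseBound ⟹ hyperuniformity of exact minimisers` (composition K of the skeleton).
The hypothesis is the registered text of `stub_sectorFloor` verbatim.  No new definitions.
-/

namespace Summit.AtomisticToContinuum.BoseEinsteinCondensation.Cruxes.StaticResponseBound.StableFractionSquareCompletion

open MeasureTheory Filter
open scoped ENNReal NNReal
open Literature.MathematicalPhysics.QuantumManyBody.BoseGas
open Summit.AtomisticToContinuum.BoseEinsteinCondensation.Theses
open Summit.AtomisticToContinuum.BoseEinsteinCondensation.Theorems.StaticResponseBound.Negative
  (psq psq_nonneg sideLength_pos)

noncomputable section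

variable {N : ℕ} {L : ℝ}

/-- The centred structure factor is bounded by the uncentred second moment of the density wave,
`inf_c ∫|ρ̂_p − c|²|Θ|² ≤ ‖ρ̂_p‖²_Θ` (centre `c = 0`; `planeWaveSum = densityWave`). [folklore] -/
theorem fb_iInf_le_weightedNormSq (L : ℝ) (Θ : Config N → ℂ) (m : Fin 3 → ℤ) :
    (⨅ c : ℂ, ∫⁻ X in cellN N L,
        (‖(∑ j : Fin N, Complex.exp (Complex.I * ↑(2 * Real.pi / L * ∑ t : Fin 3, (m t : ℝ) * X j t)))
            - c‖₊ : ℝ≥0∞) ^ 2 * (‖Θ X‖₊ : ℝ≥0∞) ^ 2) ≤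
      weightedNormSq L Θ (planeWaveSum L m) := by
  refine (iInf_le _ (0 : ℂ)).trans (le_of_eq ?_)
  unfold weightedNormSq
  refine lintegral_congr fun X => ?_
  rw [sub_zero, planeWaveSum_eq_densityWave, densityWave_eq_sum]

/-- **Feynman–Bijl with a Poincaré floor**: `ω ≤ ω_Θ(p)` (`p = 2πm/L`, `ω ≥ 0`) gives
`ω ‖ρ̂_p‖²_Θ ≤ N|p|²` for every normalised periodic state `Θ`. [cite: Stringari1995, §3 (40)] -/
theorem fb_weightedNormSq_planeWaveSum_le (hL : 0 < L) (Θ : PeriodicTrialState N L) (m : Fin 3 → ℤ)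
    {ω : ℝ} (hfl : ENNReal.ofReal ω ≤ sectorPoincareConstant L Θ.ψ (latticeVec (2 * Real.pi / L) m)) :
    ENNReal.ofReal ω * weightedNormSq L Θ.ψ (planeWaveSum L m) ≤
      N * (‖latticeVec (2 * Real.pi / L) m‖₊ : ℝ≥0∞) ^ 2 := by
  rcases eq_or_ne (weightedNormSq L Θ.ψ (planeWaveSum L m)) 0 with h0 | h0
  · rw [h0, mul_zero]; exact bot_le
  have ht : weightedNormSq L Θ.ψ (planeWaveSum L m) ≠ ⊤ :=
    ne_top_of_le_ne_top (by rw [Θ.norm_eq, mul_one]; exact ENNReal.pow_ne_top (ENNReal.natCast_ne_top N))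
      (weightedNormSq_planeWaveSum_le L Θ.ψ m)
  have h := hfl.trans (Θ.sectorPoincareConstant_latticeVec_le hL m h0)
  exact (ENNReal.le_div_iff_mul_le (Or.inl h0) (Or.inl ht)).1 h

/-- `‖2πm/L‖² = psq L m` in `[0, ∞]`. [folklore] -/
theorem fb_nnnorm_latticeVec_sq (L : ℝ) (m : Fin 3 → ℤ) :
    (‖latticeVec (2 * Real.pi / L) m‖₊ : ℝ≥0∞) ^ 2 = ENNReal.ofReal (psq L m) := by
  rw [← ENNReal.coe_pow, ← ENNReal.ofReal_coe_nnreal, NNReal.coe_pow, coe_nnnorm,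
    b1_norm_latticeVec_sq]
  rfl

/-- **Feynman–Bijl at fixed volume**: a Poincaré floor `0 < ω ≤ ω_Θ(p)` of a normalised periodic
state bounds its centred structure factor at `p = 2πm/L`: `inf_c ∫|ρ̂_p − c|²|Θ|² ≤ N·psq/ω`.
[cite: Stringari1995, §3 (40)] -/
theorem fb_structureFactor_le (hL : 0 < L) (Θ : PeriodicTrialState N L) (m : Fin 3 → ℤ)
    {ω : ℝ} (hω : 0 < ω)
    (hfl : ENNReal.ofReal ω ≤ sectorPoincareConstant L Θ.ψ (latticeVec (2 * Real.pi / L) m)) :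
    (⨅ c : ℂ, ∫⁻ X in cellN N L,
        (‖(∑ j : Fin N, Complex.exp (Complex.I * ↑(2 * Real.pi / L * ∑ t : Fin 3, (m t : ℝ) * X j t)))
            - c‖₊ : ℝ≥0∞) ^ 2 * (‖Θ.ψ X‖₊ : ℝ≥0∞) ^ 2) ≤
      ENNReal.ofReal (N * psq L m / ω) := by
  have hFB := fb_weightedNormSq_planeWaveSum_le hL Θ m hfl
  rw [fb_nnnorm_latticeVec_sq] at hFB
  refine (fb_iInf_le_weightedNormSq L Θ.ψ m).trans ?_
  have hWle : weightedNormSq L Θ.ψ (planeWaveSum L m) ≤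
      (N * ENNReal.ofReal (psq L m)) / ENNReal.ofReal ω := by
    rw [ENNReal.le_div_iff_mul_le (Or.inl ((ENNReal.ofReal_pos.2 hω).ne'))
      (Or.inl ENNReal.ofReal_ne_top), mul_comm]
    exact hFB
  refine hWle.trans (le_of_eq ?_)
  rw [← ENNReal.ofReal_natCast, ← ENNReal.ofReal_mul (Nat.cast_nonneg N),
    ← ENNReal.ofReal_div_of_pos hω]

/-- `psq L m > 0` for `m ≠ 0` and `L ≠ 0`… in fact for every `L`, as `(2π/L)²` may vanish only for
`L = 0`; we only need: `m ≠ 0 ⇒ ∑ mᵢ² > 0`. [folklore] -/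
theorem fb_sum_sq_pos {m : Fin 3 → ℤ} (hm : m ≠ 0) : 0 < ∑ i, (m i : ℝ) ^ 2 := by
  obtain ⟨i, hi⟩ : ∃ i, m i ≠ 0 := by
    by_contra h
    push Not at h
    exact hm (funext h)
  have hi' : (0 : ℝ) < (m i : ℝ) ^ 2 := by positivity
  exact lt_of_lt_of_le hi' (Finset.single_le_sum (fun j _ => sq_nonneg ((m j : ℝ))) (Finset.mem_univ i))

/-- **Hyperuniformity of exact torus ground states from the sector floor (Feynman–Bijl), all `N ≥ 1`.**
If the line's core B holds (registered text of `stub_sectorFloor`: Landau floor `θ_L√(ρa)·min(|q|, M₀√(ρa))`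
above `E₀` in every sector `q ≠ 0`, all `N ≥ 1`, `ρ < ρ₀`), then for every real, translation-invariant
periodic trial state `Θ` ATTAINING the finite ground-state energy at `L = (N/ρ)^{1/3}` and every window mode
`m ≠ 0`, `|p| ≤ M₀√(ρa)`: `inf_c ∫|ρ̂_p − c|²|Θ|² ≤ N|p|/(θ_L√(ρa))` — the body of TorusHyperuniformity
(stmt-9093) for exact minimisers with `C = 1/θ_L`, for ALL `N`. [cite: Stringari1995, §3 (40)] -/
theorem hyperuniformity_of_sectorFloor :
    (∀ v : ℝ → ℝ≥0∞, IsRepulsiveFiniteRange v → ∀ M₀ : ℝ, 0 < M₀ →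
      ∃ θL : ℝ, 0 < θL ∧ ∃ ρ₀ : ℝ, 0 < ρ₀ ∧ ∀ ρ : ℝ, 0 < ρ → ρ < ρ₀ → ∀ N : ℕ, 0 < N →
        ∀ m : Fin 3 → ℤ, m ≠ 0 →
          periodicGroundStateEnergy v N (sideLength ρ N)
              + ENNReal.ofReal (θL * Real.sqrt (ρ * (scatteringLength v).toReal)
                  * min (Real.sqrt (psq (sideLength ρ N) m))
                        (M₀ * Real.sqrt (ρ * (scatteringLength v).toReal)))
            ≤ momentumSectorEnergy v N (sideLength ρ N)
                ((2 * Real.pi / sideLength ρ N) •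
                  (WithLp.toLp 2 fun t => (m t : ℝ) : EuclideanSpace ℝ (Fin 3)))) →
    ∀ v : ℝ → ℝ≥0∞, IsRepulsiveFiniteRange v → ∀ M₀ : ℝ, 0 < M₀ →
      ∃ θL : ℝ, 0 < θL ∧ ∃ ρ₀ : ℝ, 0 < ρ₀ ∧ ∀ ρ : ℝ, 0 < ρ → ρ < ρ₀ → ∀ N : ℕ, 0 < N →
        ∀ m : Fin 3 → ℤ, m ≠ 0 →
          Real.sqrt (psq (sideLength ρ N) m) ≤ M₀ * Real.sqrt (ρ * (scatteringLength v).toReal) →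
          ∀ Θ : PeriodicTrialState N (sideLength ρ N), (∀ X, Θ.ψ X = (‖Θ.ψ X‖ : ℂ)) →
            HasTotalMomentum 0 Θ.ψ →
            periodicEnergy v Θ = periodicGroundStateEnergy v N (sideLength ρ N) →
            periodicEnergy v Θ ≠ ⊤ →
            (⨅ c : ℂ, ∫⁻ X in cellN N (sideLength ρ N),
                (‖(∑ j : Fin N, Complex.exp (Complex.I *
                    ↑(2 * Real.pi / sideLength ρ N * ∑ t : Fin 3, (m t : ℝ) * X j t))) - c‖₊ : ℝ≥0∞) ^ 2 *
                  (‖Θ.ψ X‖₊ : ℝ≥0∞) ^ 2) ≤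
              ENNReal.ofReal (N * Real.sqrt (psq (sideLength ρ N) m) /
                (θL * Real.sqrt (ρ * (scatteringLength v).toReal))) := by
  intro hB v hv M₀ hM₀
  obtain ⟨θL, hθL, ρ₀, hρ₀, hfloor⟩ := hB v hv M₀ hM₀
  refine ⟨θL, hθL, ρ₀, hρ₀, fun ρ hρ hρρ₀ N hN m hm hwin Θ hreal htr hmin hfin => ?_⟩
  have hL : 0 < sideLength ρ N := sideLength_pos hρ hN
  -- positivity of the mode and of `ρa` (the window is non-empty)
  have hpsq : 0 < psq (sideLength ρ N) m := by
    unfold psq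
    have := fb_sum_sq_pos hm
    positivity
  have hPpos : 0 < Real.sqrt (psq (sideLength ρ N) m) := Real.sqrt_pos.2 hpsq
  have hρa : 0 < ρ * (scatteringLength v).toReal := by
    by_contra hle
    push Not at hle
    have hs : Real.sqrt (ρ * (scatteringLength v).toReal) = 0 := Real.sqrt_eq_zero'.2 hle
    have : Real.sqrt (psq (sideLength ρ N) m) ≤ 0 := by
      have h := hwin
      rw [hs, mul_zero] at h
      exact h
    linarith
  have hω : 0 < θL * Real.sqrt (ρ * (scatteringLength v).toReal) * Real.sqrt (psq (sideLength ρ N) m) := by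
    positivity
  -- the floor at this (N, L, m), the saturation resolved by the window, the momentum as a lattice vector
  have hsec : periodicGroundStateEnergy v N (sideLength ρ N) +
      ENNReal.ofReal (θL * Real.sqrt (ρ * (scatteringLength v).toReal) * Real.sqrt (psq (sideLength ρ N) m)) ≤
      momentumSectorEnergy v N (sideLength ρ N) (latticeVec (2 * Real.pi / sideLength ρ N) m) := by
    have h := hfloor ρ hρ hρρ₀ N hN m hm
    rw [min_eq_left hwin, b1_smul_toLp_eq_latticeVec] at h
    exact h
  -- B4: energy floor ⇒ Poincaré floor of the minimiser's weight; then Feynman–Bijl at fixed volume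
  have hPoin := stub_energyFloorToPoincareFloor v N (sideLength ρ N) hL Θ hreal htr hmin hfin m _ hω.le hsec
  refine (fb_structureFactor_le hL Θ m hω hPoin).trans (le_of_eq ?_)
  congr 1
  set P : ℝ := Real.sqrt (psq (sideLength ρ N) m) with hPdef
  have hP2 : psq (sideLength ρ N) m = P ^ 2 := by rw [hPdef, Real.sq_sqrt (psq_nonneg _ m)]
  rw [hP2]
  have hs : Real.sqrt (ρ * (scatteringLength v).toReal) ≠ 0 := (Real.sqrt_pos.2 hρa).ne'
  field_simp

end

end Summit.AtomisticToContinuum.BoseEinsteinCondensation.Cruxes.StaticResponseBound.StableFractionSquareCompletion
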